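import Summits.QuantumFields.YangMills.Theorems.SwapVirialDeficitZeroModeSigmaFourSmallBallSection
import HarnessLib

/-!
# Exact zero-mode rung Z5 — the σ-TWISTED FOUR-LEADER small ball, II: the dilations and the EXACT factor `t⁷`
# (LEAD ym-line-sfw-p2 g93 07:46Z «`Haar⁴{E_σ(t)} = v₇t⁷(1 + O(t^θ))`»; free-hands support of ⟨stmt-QuantumFields-24197⟩)

After part I (`Haar⁴(E_σ(t)) = ∫ coneThree (transSet t A(a)) dcone(a)`, hub `A(a) = radialUnit (axisPoint a)` axial, slaved letter entered as
`p·ẑ` so that its first seam relation is the `t`-ball about `1`), the blow-up: the transversal parts `(x_J, x_K)`, `(y_J, y_K)` of the two pair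
letters are dilated by `t` (✓`ZeroModeGroup.dilate`, Jacobian `t²` each, as in fcl-p3 g44's Z4 chain) and the WHOLE imaginary part of the slaved
letter is dilated by `t` (`dilateIm`, Jacobian `t³`) — total Jacobian `t⁷ = t^{codim}` of the generic (torus) stratum of `Hom(ℤ³ ⋊_σ ℤ, SU(2))`.
* §7 `dilateIm t (z₀, z_I, z_J, z_K) = (z₀, t z_I, t z_J, t z_K)` (conjugate of `diag(1,t,t,t)` by ✓`Quaternion.linearIsometryEquivTuple`), `det = t³`;
* §8 the product dilation `dil3 t = (D_t × D_t) × D³_t` on `(ℍ × ℍ) × ℍ`, `det = t⁷` (✓`LinearMap.det_prodMap`);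
* §9 `coneThree = coneConst³ • vol³|_{B³}` (✓`Measure.prod_restrict`, ✓`prod_smul_left/right`);
* §10 the rescaled event `rescaledSigma t A = (dil3 t)⁻¹(transSet t A ∩ B³)` and ★★ `haar_sigmaBall_eq_scaled`:
  `Haar⁴(E_σ(t)) = t⁷ · coneConst³ · ∫ vol³(rescaledSigma t A(a)) dcone(a)` for every `t > 0` — EXACT, by ✓`Measure.addHaar_preimage_linearMap`;
  `mem_rescaledSigma_iff` spells the rescaled relations out.
Parts III–V: the limit event `rescaledSigma 0⁺`, the dominator from the four load-bearing constraints of LEAD g93's ceiling, dominated convergence.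
HONEST LABEL: finite-dimensional measure theory on `SU(2)⁴` (plan-level zero-mode rung of the DRAFT line «sharp-sigma»); NOT the fixed-`L` sharp law,
NOT ⟨24197⟩; own crux ⟨22884⟩ OPEN (blocked-on ⟨19935⟩); the Yang–Mills mass gap is NOT proved; no summit is proved by a line.
Width seat ym-line-sfw-p2-w3 g63 (cell ym-idea-1, free hands), `--supports stmt-QuantumFields-24197`.  Standard axioms, 0 `sorry`.
References: [cite: GonzalezarroyoAltes1988]; [cite: Vanbaal2001]; [cite: Luscher1983, §2]; [folklore].
-/

set_option autoImplicit false

noncomputable section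

open MeasureTheory Quaternion Set
open scoped Quaternion ENNReal BigOperators
open Literature.MathematicalPhysics.QuantumLattice
open Literature.MathematicalPhysics.QuantumFieldTheory (haarProbability)
open Literature.Analysis.Calculus (radialUnit radialUnit_def norm_radialUnit)
open Summit.QuantumFields.YangMills.Theorems.SwapTwistDeficit.ToronLog
open Summit.QuantumFields.YangMills.Theorems.SwapVirialDeficit.ZeroModeGroup

attribute [local instance] Literature.Analysis.FluidPDE.Tao2016.quatMeasurableSpace
  Literature.Analysis.FluidPDE.Tao2016.quatBorelSpace
  Literature.MathematicalPhysics.QuantumLattice.secondCountableTopology_su2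

namespace Summit.QuantumFields.YangMills.Theorems.SwapVirialDeficit.ZeroModeSigma

/-! ## §7 The imaginary dilation `D³_t` of the slaved letter -/

/-- The diagonal map `diag(1, t, t, t)` on `ℝ⁴` (cf. ✓`ZeroModeGroup.diag4 = diag(1,1,t,t)`). [folklore] -/
def diag4Im (t : ℝ) : EuclideanSpace ℝ (Fin 4) →ₗ[ℝ] EuclideanSpace ℝ (Fin 4) :=
  eX4.toLinearMap ∘ₗ (Matrix.toLin' (Matrix.diagonal ![1, t, t, t]) ∘ₗ eX4.symm.toLinearMap)

/-- `diag4Im` in coordinates. [folklore] -/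
theorem diag4Im_apply (t : ℝ) (u : EuclideanSpace ℝ (Fin 4)) (i : Fin 4) : (diag4Im t u) i = (![1, t, t, t] i) * u i := by
  simp [diag4Im, eX4, Matrix.toLin'_apply, Matrix.mulVec_diagonal]

/-- `det diag(1,t,t,t) = t³`. [folklore] -/
theorem det_diag4Im (t : ℝ) : LinearMap.det (diag4Im t) = t ^ 3 := by
  unfold diag4Im
  rw [LinearMap.det_conj (Matrix.toLin' (Matrix.diagonal ![1, t, t, t])) eX4, LinearMap.det_toLin', Matrix.det_diagonal,
    Fin.prod_univ_four]
  simp; ring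

/-- **The imaginary dilation** `D³_t (z₀, z_I, z_J, z_K) = (z₀, t·z_I, t·z_J, t·z_K)` as a linear map of `ℍ`. [folklore] -/
def dilateIm (t : ℝ) : ℍ →ₗ[ℝ] ℍ :=
  Quaternion.linearIsometryEquivTuple.toLinearEquiv.symm.toLinearMap ∘ₗ
    (diag4Im t ∘ₗ Quaternion.linearIsometryEquivTuple.toLinearEquiv.symm.symm.toLinearMap)

/-- `det D³_t = t³`. [folklore] -/
theorem det_dilateIm (t : ℝ) : LinearMap.det (dilateIm t) = t ^ 3 := by
  unfold dilateIm
  rw [LinearMap.det_conj (diag4Im t) Quaternion.linearIsometryEquivTuple.toLinearEquiv.symm, det_diag4Im]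

/-- `D³_t` in coordinates. [folklore] -/
theorem dilateIm_apply (t : ℝ) (z : ℍ) : dilateIm t z = ⟨z.re, t * z.imI, t * z.imJ, t * z.imK⟩ := by
  have h : dilateIm t z = Quaternion.linearIsometryEquivTuple.symm (diag4Im t (Quaternion.linearIsometryEquivTuple z)) := rfl
  rw [h, Quaternion.linearIsometryEquivTuple_symm_apply]
  have hc : ∀ i : Fin 4, (diag4Im t (Quaternion.linearIsometryEquivTuple z)) i = (![1, t, t, t] i) * (Quaternion.linearIsometryEquivTuple z) i :=
    fun i => diag4Im_apply t _ i
  rw [hc 0, hc 1, hc 2, hc 3]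
  simp [Quaternion.linearIsometryEquivTuple_apply]

/-- Components of `D³_t z`. [folklore] -/
theorem dilateIm_re (t : ℝ) (z : ℍ) : (dilateIm t z).re = z.re := by rw [dilateIm_apply]

/-- Components of `D³_t z`. [folklore] -/
theorem dilateIm_imI (t : ℝ) (z : ℍ) : (dilateIm t z).imI = t * z.imI := by rw [dilateIm_apply]

/-- Components of `D³_t z`. [folklore] -/
theorem dilateIm_imJ (t : ℝ) (z : ℍ) : (dilateIm t z).imJ = t * z.imJ := by rw [dilateIm_apply]

/-- Components of `D³_t z`. [folklore] -/
theorem dilateIm_imK (t : ℝ) (z : ℍ) : (dilateIm t z).imK = t * z.imK := by rw [dilateIm_apply]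

/-- `‖D³_t z‖² = z₀² + t²‖Im z‖²` in coordinates. [folklore] -/
theorem norm_sq_dilateIm (t : ℝ) (z : ℍ) : ‖dilateIm t z‖ ^ 2 = z.re ^ 2 + t ^ 2 * (z.imI ^ 2 + z.imJ ^ 2 + z.imK ^ 2) := by
  rw [sq_norm_eq_sum_sq, dilateIm_re, dilateIm_imI, dilateIm_imJ, dilateIm_imK]; ring

/-- `D³_t` is continuous. [folklore] -/
theorem continuous_dilateIm (t : ℝ) : Continuous (dilateIm t) := LinearMap.continuous_of_finiteDimensional _

/-! ## §8 The product dilation `(D_t × D_t) × D³_t` and its Jacobian `t⁷` -/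

/-- The product dilation of the three non-hub letters: `D_t` on the pair letters, `D³_t` on the slaved letter. [folklore] -/
def dil3 (t : ℝ) : ((ℍ × ℍ) × ℍ) →ₗ[ℝ] ((ℍ × ℍ) × ℍ) := ((dilate t).prodMap (dilate t)).prodMap (dilateIm t)

/-- `dil3` componentwise. [folklore] -/
theorem dil3_apply (t : ℝ) (w : (ℍ × ℍ) × ℍ) : dil3 t w = ((dilate t w.1.1, dilate t w.1.2), dilateIm t w.2) := rfl

/-- ★ `det ((D_t × D_t) × D³_t) = t⁷` — the codimension of the torus stratum of `Hom(ℤ³ ⋊_σ ℤ, SU(2))`. [folklore] -/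
theorem det_dil3 (t : ℝ) : LinearMap.det (dil3 t) = t ^ 7 := by
  unfold dil3
  rw [LinearMap.det_prodMap, LinearMap.det_prodMap, det_dilate, det_dilateIm]; ring

/-- `dil3 t` is continuous, hence measurable. [folklore] -/
theorem measurable_dil3 (t : ℝ) : Measurable (dil3 t) := (LinearMap.continuous_of_finiteDimensional _).measurable

/-! ## §9 `coneThree` as a restricted Lebesgue measure -/

/-- The product of the three unit balls. [folklore] -/
def ball3 : Set ((ℍ × ℍ) × ℍ) := (Metric.ball (0 : ℍ) 1 ×ˢ Metric.ball (0 : ℍ) 1) ×ˢ Metric.ball (0 : ℍ) 1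

/-- Membership in `ball3`. [folklore] -/
theorem mem_ball3_iff (w : (ℍ × ℍ) × ℍ) : w ∈ ball3 ↔ (‖w.1.1‖ < 1 ∧ ‖w.1.2‖ < 1) ∧ ‖w.2‖ < 1 := by
  simp only [ball3, Set.mem_prod, Metric.mem_ball, dist_zero_right]

/-- `ball3` is measurable. [folklore] -/
theorem measurableSet_ball3 : MeasurableSet ball3 := (measurableSet_ball.prod measurableSet_ball).prod measurableSet_ball

/-- Lebesgue measure on `(ℍ × ℍ) × ℍ` is an additive Haar measure. [folklore] -/
theorem isAddHaarMeasure_volume3 : (volume : Measure ((ℍ × ℍ) × ℍ)).IsAddHaarMeasure := by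
  haveI h2 : (volume : Measure (ℍ × ℍ)).IsAddHaarMeasure := Measure.prod.instIsAddHaarMeasure _ _
  exact Measure.prod.instIsAddHaarMeasure _ _

/-- ★ **`coneThree = coneConst³ · vol³|_{B³}`.** [folklore] -/
theorem coneThree_eq_smul_restrict : coneThree = (ENNReal.ofReal coneConst ^ 3) • (volume : Measure ((ℍ × ℍ) × ℍ)).restrict ball3 := by
  rw [coneThree_def, coneMeasure, inv_volume_ball_eq]
  set k : ℝ≥0∞ := ENNReal.ofReal coneConst
  have h2 : (k • (volume : Measure ℍ).restrict (Metric.ball 0 1)).prod (k • (volume : Measure ℍ).restrict (Metric.ball 0 1)) =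
      (k * k) • ((volume : Measure ℍ).prod volume).restrict (Metric.ball 0 1 ×ˢ Metric.ball 0 1) := by
    rw [Measure.prod_smul_left, Measure.prod_smul_right, Measure.prod_restrict, smul_smul]
  rw [h2, Measure.prod_smul_left, Measure.prod_smul_right, Measure.prod_restrict, smul_smul, show k * k * k = k ^ 3 by ring]
  rfl

/-- `coneThree S = coneConst³ · vol³(S ∩ B³)` for measurable `S`. [folklore] -/
theorem coneThree_apply {S : Set ((ℍ × ℍ) × ℍ)} (hS : MeasurableSet S) :
    coneThree S = ENNReal.ofReal coneConst ^ 3 * volume (S ∩ ball3) := by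
  rw [coneThree_eq_smul_restrict, Measure.smul_apply, Measure.restrict_apply hS, smul_eq_mul]

/-! ## §10 The rescaled event and the exact `t⁷` -/

/-- ★ **The rescaled σ-event** at an axial hub unit `A`: `(x, y, z) ∈ rescaledSigma t A` iff the dilated letters `(D_t x, D_t y, D³_t z)` lie in the unit
balls and satisfy the six translated relations (`transSet t A`) — for `t > 0` exactly the `dil3 t`-preimage; its `t → 0⁺` limit is part III.
[folklore] -/
def rescaledSigma (t : ℝ) (A : ℍ) : Set ((ℍ × ℍ) × ℍ) := (dil3 t) ⁻¹' (transSet t A ∩ ball3)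

/-- Unfolding `rescaledSigma` as a preimage. [folklore] -/
theorem rescaledSigma_def (t : ℝ) (A : ℍ) : rescaledSigma t A = (dil3 t) ⁻¹' (transSet t A ∩ ball3) := rfl

/-- ★ **Membership in the rescaled event, spelled out**: with `x' = D_t x`, `y' = D_t y`, `z' = D³_t z`, `p = slaveP A x'`:
`‖x'‖, ‖y'‖, ‖z'‖ < 1` and `(radialUnit x', p·radialUnit z', radialUnit y', A) ∈ sigmaSet t`. [folklore] -/
theorem mem_rescaledSigma_iff (t : ℝ) (A : ℍ) (w : (ℍ × ℍ) × ℍ) :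
    w ∈ rescaledSigma t A ↔
      ((radialUnit (dilate t w.1.1), slaveP A (dilate t w.1.1) * radialUnit (dilateIm t w.2), radialUnit (dilate t w.1.2), A) ∈ sigmaSet t) ∧
        (‖dilate t w.1.1‖ < 1 ∧ ‖dilate t w.1.2‖ < 1) ∧ ‖dilateIm t w.2‖ < 1 := by
  rw [rescaledSigma, Set.mem_preimage, Set.mem_inter_iff, dil3_apply, mem_transSet_iff, mem_ball3_iff]

/-- `rescaledSigma t A` is measurable. [folklore] -/
theorem measurableSet_rescaledSigma (t : ℝ) (A : ℍ) : MeasurableSet (rescaledSigma t A) :=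
  ((measurableSet_transSet t A).inter measurableSet_ball3).preimage (measurable_dil3 t)

/-- ★ **The exact Jacobian**: `vol³(transSet t A ∩ B³) = t⁷ · vol³(rescaledSigma t A)` for `t > 0`. [folklore] -/
theorem volume_transSet_inter_ball3 {t : ℝ} (ht : 0 < t) (A : ℍ) :
    volume (transSet t A ∩ ball3) = ENNReal.ofReal (t ^ 7) * volume (rescaledSigma t A) := by
  haveI := isAddHaarMeasure_volume3
  have hdet : LinearMap.det (dil3 t) ≠ 0 := by rw [det_dil3]; positivity
  have h7 : 0 < t ^ 7 := by positivity
  rw [rescaledSigma, Measure.addHaar_preimage_linearMap (μ := (volume : Measure ((ℍ × ℍ) × ℍ))) hdet, det_dil3, abs_inv,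
    abs_of_pos h7, ← mul_assoc, ← ENNReal.ofReal_mul h7.le, mul_inv_cancel₀ h7.ne', ENNReal.ofReal_one, one_mul]

/-- `coneThree (transSet t A) = coneConst³ · t⁷ · vol³(rescaledSigma t A)` for `t > 0`. [folklore] -/
theorem coneThree_transSet {t : ℝ} (ht : 0 < t) (A : ℍ) :
    coneThree (transSet t A) = ENNReal.ofReal (t ^ 7) * (ENNReal.ofReal coneConst ^ 3 * volume (rescaledSigma t A)) := by
  rw [coneThree_apply (measurableSet_transSet t A), volume_transSet_inter_ball3 ht, ← mul_assoc, ← mul_assoc, mul_comm (ENNReal.ofReal coneConst ^ 3)]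

/-- The hub integrand `a ↦ vol³(rescaledSigma t (radialUnit (axisPoint a)))` is measurable (a section measure of a jointly measurable set). [folklore] -/
theorem measurable_volume_rescaledSigma (t : ℝ) : Measurable fun a : ℍ => volume (rescaledSigma t (radialUnit (axisPoint a))) := by
  -- the joint set `{(a, w) | w ∈ rescaledSigma t (A(a))}` is measurable
  have hA : Measurable fun q : ℍ × ((ℍ × ℍ) × ℍ) => radialUnit (axisPoint q.1) := measurable_axisUnit.comp measurable_fst
  have hD : Measurable fun q : ℍ × ((ℍ × ℍ) × ℍ) => dil3 t q.2 := (measurable_dil3 t).comp measurable_snd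
  have hx : Measurable fun q : ℍ × ((ℍ × ℍ) × ℍ) => (dil3 t q.2).1.1 := measurable_fst.comp (measurable_fst.comp hD)
  have hy : Measurable fun q : ℍ × ((ℍ × ℍ) × ℍ) => (dil3 t q.2).1.2 := measurable_snd.comp (measurable_fst.comp hD)
  have hz : Measurable fun q : ℍ × ((ℍ × ℍ) × ℍ) => (dil3 t q.2).2 := measurable_snd.comp hD
  have hS : MeasurableSet {q : ℍ × ((ℍ × ℍ) × ℍ) |
      (radialUnit (dil3 t q.2).1.1, slaveP (radialUnit (axisPoint q.1)) (dil3 t q.2).1.1 * radialUnit (dil3 t q.2).2,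
        radialUnit (dil3 t q.2).1.2, radialUnit (axisPoint q.1)) ∈ sigmaSet t} :=
    measurableSet_preimage_sigmaSet t (measurable_radialUnit.comp hx) ((measurable_slaveP.comp (hA.prodMk hx)).mul (measurable_radialUnit.comp hz))
      (measurable_radialUnit.comp hy) hA
  have hB : MeasurableSet {q : ℍ × ((ℍ × ℍ) × ℍ) | dil3 t q.2 ∈ ball3} := measurableSet_ball3.preimage hD
  have hJ : MeasurableSet ({q : ℍ × ((ℍ × ℍ) × ℍ) |
      (radialUnit (dil3 t q.2).1.1, slaveP (radialUnit (axisPoint q.1)) (dil3 t q.2).1.1 * radialUnit (dil3 t q.2).2,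
        radialUnit (dil3 t q.2).1.2, radialUnit (axisPoint q.1)) ∈ sigmaSet t} ∩ {q | dil3 t q.2 ∈ ball3}) := hS.inter hB
  have hsec : ∀ a : ℍ, Prod.mk a ⁻¹' ({q : ℍ × ((ℍ × ℍ) × ℍ) |
      (radialUnit (dil3 t q.2).1.1, slaveP (radialUnit (axisPoint q.1)) (dil3 t q.2).1.1 * radialUnit (dil3 t q.2).2,
        radialUnit (dil3 t q.2).1.2, radialUnit (axisPoint q.1)) ∈ sigmaSet t} ∩ {q | dil3 t q.2 ∈ ball3}) =
      rescaledSigma t (radialUnit (axisPoint a)) := by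
    intro a; ext w
    simp only [Set.mem_preimage, Set.mem_inter_iff, Set.mem_setOf_eq, rescaledSigma, mem_transSet_iff, dil3_apply]
  have h := measurable_measure_prodMk_left (ν := (volume : Measure ((ℍ × ℍ) × ℍ))) hJ
  simp only [hsec] at h
  exact h

/-- ★★ **THE EXACT `t⁷`**: for every `t > 0`,
`Haar⁴(E_σ(t)) = t⁷ · coneConst³ · ∫ vol³(rescaledSigma t (radialUnit (axisPoint a))) dcone(a)`. [folklore] -/
theorem haar_sigmaBall_eq_scaled {t : ℝ} (ht : 0 < t) :
    (Measure.pi fun _ : Fin 4 => haarProbability (Matrix.specialUnitaryGroup (Fin 2) ℂ)) (sigmaBall t) =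
      ENNReal.ofReal (t ^ 7) * (ENNReal.ofReal coneConst ^ 3 * ∫⁻ a, volume (rescaledSigma t (radialUnit (axisPoint a))) ∂coneMeasure) := by
  have hm := measurable_volume_rescaledSigma t
  rw [haar_sigmaBall_eq_lintegral ht.le]
  simp only [coneThree_transSet ht]
  rw [lintegral_const_mul _ (hm.const_mul _), lintegral_const_mul _ hm]

/-- ★ The same as a quotient: `Haar⁴(E_σ(t))/t⁷ = (coneConst³ · ∫ vol³(rescaledSigma t A(a)) dcone(a)).toReal` (`t > 0`). [folklore] -/
theorem haar_sigmaBall_div_pow_seven {t : ℝ} (ht : 0 < t) :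
    ((Measure.pi fun _ : Fin 4 => haarProbability (Matrix.specialUnitaryGroup (Fin 2) ℂ)) (sigmaBall t)).toReal / t ^ 7 =
      (ENNReal.ofReal coneConst ^ 3 * ∫⁻ a, volume (rescaledSigma t (radialUnit (axisPoint a))) ∂coneMeasure).toReal := by
  have h7 : 0 < t ^ 7 := by positivity
  rw [haar_sigmaBall_eq_scaled ht, ENNReal.toReal_mul, ENNReal.toReal_ofReal h7.le, mul_div_cancel_left₀ _ h7.ne']

end Summit.QuantumFields.YangMills.Theorems.SwapVirialDeficit.ZeroModeSigma

end
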